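import Mathlib

/-! # T5DiscriminantParity — the discriminant-parity step of (A13) (§N5.13.2) in kernel form

Blind cell pub-hodge-repro2, seat p4 (Tier-5 kernel annex, README §7; record-class, cited by p-id
or ignored, never an input). README §8(d): uses an L-value-free non-vanishing device: NO.

The owner's step (route/T5-route-2.md §N5.13.2, (iii-ramified)′): «writing `E_v = F_v(√D)` with
`D ∈ O_{F_v}`, … `d(E_v/F_v) = v_F(4D) − 2i ≡ v_F(D) = v_E(√D) (mod 2)` (the discriminant `4D` of
`O_{F_v}[√D]` equals the discriminant of `O_{E_v}` times the square of the index ideal `P_F^i` of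
`O_{F_v}[√D]` in `O_{E_v}`, and `v_F(disc(O_{E_v})) = v_F(N𝔇) = d(E_v/F_v)` as the residue degree
is 1; `v_F(4)` is even)».  This is the hypothesis `hd` that `T5RamifiedParity.even_conductor`
(p393398) takes as given.

Kernel content — `A = O_{F_v}` is any domain, `B = O_{E_v}` any commutative `A`-algebra free of rank
two (`b : Basis (Fin 2) A B`), `s = √D ∈ B` with `s * s = algebraMap A B D` and `s ∉ A`; no field,
no valuation ring, no different is modelled:
* `trace_eq_zero_of_sq_eq_algebraMap` : `trace_{B/A} s = 0` (the `2 × 2` multiplication matrix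
  `M` of `s` satisfies `M * M = D • 1`; a non-zero trace forces its off-diagonal entries to vanish
  and its diagonal entries to agree, so `M` is scalar and `s ∈ A` — `eq_smul_one_of_mul_self_eq_of_trace_ne_zero`);
* `discr_one_sqrt` : `discr_A (1, s) = 4 * D` — «the discriminant `4D` of `O_{F_v}[√D]`»;
* `discr_eq_det_toMatrix_sq_mul` : `discr_A c = det (b.toMatrix c) ^ 2 * discr_A b` for every
  family `c` and every basis `b` — «the discriminant of the order equals the discriminant of
  `O_{E_v}` times the square of the index» (Mathlib's `Algebra.discr_of_matrix_vecMul`);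
* `four_mul_eq_det_sq_mul_discr` : `4 * D = det P ^ 2 * discr_A b`, `P` the matrix of `(1, s)`
  in the basis `b`;
* `even_log_val_discr_sub_log_val` / `log_val_discr_modEq` : for `v : Valuation A ℤᵐ⁰` with
  `v D ≠ 0` and `v 2 ≠ 0`, `log (v (discr_A b)) ≡ log (v D) [ZMOD 2]` — «`v_F(disc O_{E_v}) ≡ v_F(D)
  (mod 2)`» in the `ord = −log` convention of `T5RamifiedParity`;
* `val_discr_eq_of_basis` : `v (discr_A b') = v (discr_A b)` for two bases when `v ≤ 1` on `A`
  («`v_F(disc O_{E_v})`» does not depend on the basis: the change-of-basis determinant is a unit,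
  `val_eq_one_of_isUnit`);
* `different_exponent_modEq` : the step in the owner's notation, with «`d(E_v/F_v) = v_F(disc O_{E_v})`»
  as the explicit hypothesis.

Stays prose (not in Mathlib for relative extensions of discrete valuation rings):
`v_F(disc O_{E_v}) = v_F(N 𝔇) = d(E_v/F_v)` (norm of the different = discriminant ideal; residue
degree 1) — Mathlib has it over `ℤ` only (`NumberField.absNorm_differentIdeal`) —, and the
local-field facts that `(1, √D) ⊂ O_{E_v}` with `√D ∉ F_v` and that `O_{E_v}` is free of rank two
over `O_{F_v}`.
-/

namespace Summit.Ventures.HodgeRepro2.T5DiscriminantParity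

open Module Matrix

section Trace

variable {A B : Type*} [CommRing A] [CommRing B] [Algebra A B]

/-- A `2 × 2` matrix `M` over a domain with `M * M = D • 1` and `trace M ≠ 0` is scalar
(`M = M 0 0 • 1`): the off-diagonal entries are killed by `M 0 1 * trace M = 0`, and the diagonal
entries agree because `(M 1 1 - M 0 0) * trace M = 0`. -/
theorem eq_smul_one_of_mul_self_eq_of_trace_ne_zero [IsDomain A] (M : Matrix (Fin 2) (Fin 2) A)
    (D : A) (hM : M * M = D • (1 : Matrix (Fin 2) (Fin 2) A)) (htr : M.trace ≠ 0) :
    M = M 0 0 • (1 : Matrix (Fin 2) (Fin 2) A) := by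
  rw [Matrix.trace_fin_two] at htr
  have e01 := congrFun (congrFun hM 0) 1
  have e10 := congrFun (congrFun hM 1) 0
  have e00 := congrFun (congrFun hM 0) 0
  have e11 := congrFun (congrFun hM 1) 1
  simp only [Matrix.mul_apply, Fin.sum_univ_two, Matrix.smul_apply, Matrix.one_apply_eq,
    Matrix.one_apply_ne (show (0 : Fin 2) ≠ 1 by decide),
    Matrix.one_apply_ne (show (1 : Fin 2) ≠ 0 by decide), smul_eq_mul, mul_one]
    at e01 e10 e00 e11
  have h01 : M 0 1 * (M 0 0 + M 1 1) = 0 := by linear_combination e01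
  have h10 : M 1 0 * (M 0 0 + M 1 1) = 0 := by linear_combination e10
  have hb : M 0 1 = 0 := (mul_eq_zero.1 h01).resolve_right htr
  have hc : M 1 0 = 0 := (mul_eq_zero.1 h10).resolve_right htr
  have hdd : (M 1 1 - M 0 0) * (M 0 0 + M 1 1) = 0 := by
    linear_combination e11 - e00
  have hd : M 1 1 = M 0 0 := by
    have := (mul_eq_zero.1 hdd).resolve_right htr
    linear_combination this
  ext i j
  fin_cases i <;> fin_cases j <;> simp [hb, hc, hd]

/-- In an algebra free of rank two over a domain, an element `s` with `s * s ∈ A` and `s ∉ A` has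
trace `0`: its multiplication matrix squares to `D • 1`, so a non-zero trace would make it scalar
(`eq_smul_one_of_mul_self_eq_of_trace_ne_zero`) and hence `s = algebraMap A B (M 0 0)`
(`Algebra.leftMulMatrix_injective`). This is «`tr(√D) = 0`» behind «the discriminant `4D` of
`O_{F_v}[√D]`». -/
theorem trace_eq_zero_of_sq_eq_algebraMap [IsDomain A] (b : Basis (Fin 2) A B) (s : B) (D : A)
    (hs : s * s = algebraMap A B D) (hns : s ∉ Set.range (algebraMap A B)) :
    Algebra.trace A B s = 0 := by
  rw [Algebra.trace_eq_matrix_trace b]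
  by_contra htr
  have hM : Algebra.leftMulMatrix b s * Algebra.leftMulMatrix b s
      = D • (1 : Matrix (Fin 2) (Fin 2) A) := by
    rw [← map_mul, hs, AlgHom.commutes, Algebra.algebraMap_eq_smul_one]
  have h := eq_smul_one_of_mul_self_eq_of_trace_ne_zero _ D hM htr
  apply hns
  refine ⟨Algebra.leftMulMatrix b s 0 0, ?_⟩
  apply Algebra.leftMulMatrix_injective b
  rw [AlgHom.commutes, Algebra.algebraMap_eq_smul_one, ← h]

/-- The discriminant of the family `(1, s)` in an algebra free of rank two: `4 * D` when
`s * s = algebraMap A B D` and `trace s = 0` — «the discriminant `4D` of `O_{F_v}[√D]`»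
(`Matrix.det_fin_two` on the trace matrix `!![2, 0; 0, 2 D]`). -/
theorem discr_one_sqrt (b : Basis (Fin 2) A B) (s : B) (D : A) (hs : s * s = algebraMap A B D)
    (htr : Algebra.trace A B s = 0) :
    Algebra.discr A ![(1 : B), s] = 4 * D := by
  rw [Algebra.discr_def, Matrix.det_fin_two]
  simp only [Algebra.traceMatrix_apply, Algebra.traceForm_apply, Matrix.cons_val_zero,
    Matrix.cons_val_one, one_mul, mul_one, hs, htr, mul_zero, sub_zero]
  have h1 := Algebra.trace_algebraMap_of_basis b (1 : A)
  rw [map_one] at h1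
  rw [h1, Algebra.trace_algebraMap_of_basis b D, Fintype.card_fin, nsmul_eq_mul, nsmul_eq_mul]
  push_cast
  ring

end Trace

section ChangeOfBasis

variable {A B : Type*} [CommRing A] [CommRing B] [Algebra A B]
variable {ι : Type*} [Fintype ι] [DecidableEq ι]

omit [DecidableEq ι] in
/-- Every family `c` is `b ᵥ* (b.toMatrix c)` with the entries of the coordinate matrix mapped
into `B`. -/
theorem vecMul_toMatrix_map (b : Basis ι A B) (c : ι → B) :
    b ᵥ* (b.toMatrix c).map (algebraMap A B) = c := by
  ext j
  simp only [Matrix.vecMul, dotProduct, Matrix.map_apply, Basis.toMatrix_apply]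
  calc ∑ i, b i * algebraMap A B (b.repr (c j) i)
      = ∑ i, b.repr (c j) i • b i := by
        refine Finset.sum_congr rfl fun i _ => ?_
        rw [Algebra.smul_def, mul_comm]
    _ = c j := b.sum_repr (c j)

/-- The index-square relation: `discr_A c = det (b.toMatrix c) ^ 2 * discr_A b` for every family
`c` and every basis `b` — «the discriminant of the order `O_{F_v}[√D]` equals the discriminant of
`O_{E_v}` times the square of the index». Mathlib's `Algebra.discr_of_matrix_vecMul` on
`vecMul_toMatrix_map`. -/
theorem discr_eq_det_toMatrix_sq_mul (b : Basis ι A B) (c : ι → B) :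
    Algebra.discr A c = (b.toMatrix c).det ^ 2 * Algebra.discr A b := by
  have h := Algebra.discr_of_matrix_vecMul (⇑b) (b.toMatrix c)
  rwa [vecMul_toMatrix_map] at h

/-- `4 * D = det P ^ 2 * discr_A b` for the matrix `P = b.toMatrix ![1, s]` of `(1, s)` in the basis
`b` (`A` a domain, `s * s = D`, `s ∉ A`). -/
theorem four_mul_eq_det_sq_mul_discr [IsDomain A] (b : Basis (Fin 2) A B) (s : B) (D : A)
    (hs : s * s = algebraMap A B D) (hns : s ∉ Set.range (algebraMap A B)) :
    4 * D = (b.toMatrix ![(1 : B), s]).det ^ 2 * Algebra.discr A b := by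
  rw [← discr_one_sqrt b s D hs (trace_eq_zero_of_sq_eq_algebraMap b s D hs hns)]
  exact discr_eq_det_toMatrix_sq_mul b _

end ChangeOfBasis

section Valuation

open WithZero

variable {A : Type*} [CommRing A] (v : Valuation A ℤᵐ⁰)

/-- Parity bookkeeping in `ℤᵐ⁰`: from `e * e * d = c * c * a` with all four values non-zero,
`log (v a) - log (v d) = 2 (log (v e) - log (v c))` is even. -/
theorem even_log_sub_log_of_mul_sq_eq {a d e c : A} (h : e * e * d = c * c * a)
    (ha : v a ≠ 0) (hd : v d ≠ 0) (he : v e ≠ 0) (hc : v c ≠ 0) :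
    Even (log (v a) - log (v d)) := by
  have h' : v e * v e * v d = v c * v c * v a := by
    rw [← map_mul, ← map_mul, ← map_mul, ← map_mul, h]
  have hl := congrArg log h'
  rw [log_mul (mul_ne_zero he he) hd, log_mul he he, log_mul (mul_ne_zero hc hc) ha,
    log_mul hc hc] at hl
  exact ⟨log (v e) - log (v c), by linarith⟩

/-- «`v_F(disc O_{E_v}) ≡ v_F(D) (mod 2)`»: for `B` free of rank two over the domain `A` with basis
`b`, `s * s = D`, `s ∉ A`, and a valuation `v : A → ℤᵐ⁰` with `v D ≠ 0`, `v 2 ≠ 0`,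
`log (v (discr_A b)) - log (v D)` is even — from `4 * D = det P ^ 2 * discr_A b`
(`four_mul_eq_det_sq_mul_discr`) and `v 4 = v 2 ^ 2`. -/
theorem even_log_val_discr_sub_log_val [IsDomain A] {B : Type*} [CommRing B] [Algebra A B]
    (b : Basis (Fin 2) A B) (s : B) (D : A) (hs : s * s = algebraMap A B D)
    (hns : s ∉ Set.range (algebraMap A B)) (hD : v D ≠ 0) (h2 : v 2 ≠ 0) :
    Even (log (v (Algebra.discr A b)) - log (v D)) := by
  have h := four_mul_eq_det_sq_mul_discr b s D hs hns
  have h4 : (4 : A) = 2 * 2 := by norm_num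
  rw [h4, pow_two] at h
  set P := b.toMatrix ![(1 : B), s] with hP
  have hL : v (2 * 2 * D) ≠ 0 := by
    rw [map_mul, map_mul]; exact mul_ne_zero (mul_ne_zero h2 h2) hD
  rw [h, map_mul, map_mul] at hL
  have hdet : v P.det ≠ 0 := fun h0 => hL (by rw [h0, zero_mul, zero_mul])
  have hdisc : v (Algebra.discr A b) ≠ 0 := fun h0 => hL (by rw [h0, mul_zero])
  exact even_log_sub_log_of_mul_sq_eq v h hdisc hD h2 hdet

/-- The same as a congruence: `log (v (discr_A b)) ≡ log (v D) [ZMOD 2]`. -/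
theorem log_val_discr_modEq [IsDomain A] {B : Type*} [CommRing B] [Algebra A B]
    (b : Basis (Fin 2) A B) (s : B) (D : A) (hs : s * s = algebraMap A B D)
    (hns : s ∉ Set.range (algebraMap A B)) (hD : v D ≠ 0) (h2 : v 2 ≠ 0) :
    log (v (Algebra.discr A b)) ≡ log (v D) [ZMOD 2] := by
  have h := even_log_val_discr_sub_log_val v b s D hs hns hD h2
  rw [Int.modEq_iff_dvd, ← even_iff_two_dvd, ← neg_sub]
  exact h.neg

/-- A valuation that is `≤ 1` on `A` takes the value `1` on every unit of `A`
(`v u * v w = 1` with both factors `≤ 1`). -/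
theorem val_eq_one_of_isUnit (hv : ∀ a : A, v a ≤ 1) {u : A} (hu : IsUnit u) : v u = 1 := by
  obtain ⟨w, hw⟩ := hu.exists_right_inv
  have h1 : v u * v w = 1 := by rw [← map_mul, hw, map_one]
  refine le_antisymm (hv u) ?_
  calc (1 : ℤᵐ⁰) = v u * v w := h1.symm
    _ ≤ v u * 1 := mul_le_mul_right (hv w) _
    _ = v u := mul_one _

/-- Basis-independence of «`v_F(disc O_{E_v})`»: for two bases `b`, `b'` of `B` over `A` and a
valuation `v ≤ 1` on `A`, `v (discr_A b') = v (discr_A b)` — the change-of-basis determinant is a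
unit (`Module.Basis.isUnit_det`). -/
theorem val_discr_eq_of_basis {B : Type*} [CommRing B] [Algebra A B] {ι : Type*} [Fintype ι]
    [DecidableEq ι] (hv : ∀ a : A, v a ≤ 1) (b b' : Basis ι A B) :
    v (Algebra.discr A b') = v (Algebra.discr A b) := by
  rw [discr_eq_det_toMatrix_sq_mul b b', map_mul, map_pow, val_eq_one_of_isUnit v hv, one_pow,
    one_mul]
  rw [← Basis.det_apply]
  exact b.isUnit_det b'

/-- The step in the owner's notation: if `d = d(E_v/F_v)` equals «`v_F(disc O_{E_v})`»
`= -log (v (discr_A b))` (the prose hypothesis `hdisc`: norm of the different = discriminant,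
residue degree 1), then `d ≡ -log (v D) [ZMOD 2]`, i.e. `d(E_v/F_v) ≡ v_F(D) (mod 2)` in the
`ord = -log` convention. -/
theorem different_exponent_modEq [IsDomain A] {B : Type*} [CommRing B] [Algebra A B]
    (b : Basis (Fin 2) A B) (s : B) (D : A) (hs : s * s = algebraMap A B D)
    (hns : s ∉ Set.range (algebraMap A B)) (hD : v D ≠ 0) (h2 : v 2 ≠ 0)
    (d : ℤ) (hdisc : d = -log (v (Algebra.discr A b))) :
    d ≡ -log (v D) [ZMOD 2] := by
  rw [hdisc]
  exact (log_val_discr_modEq v b s D hs hns hD h2).neg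

end Valuation

end Summit.Ventures.HodgeRepro2.T5DiscriminantParity
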